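/-
Copyright (c) 2026 the pub-hodgecm-mathlib formalisation cell (harness21).  Prover seat hodgecm-mathlib-LH4-p05 (g3), req620 Track A «(D-RAM) FOUR-FRAME» squad
(unit U3_Laws, (R-18) «K-ABS-R := NI2 ⊕ KMS»; (KMS) ROAD «MODULO κ-STAGE B», κ-Stage A₂ HEAD (Oκ2c)-MULT = the payer of the U3 ED. 9 child (κ-A₂)
`stub_U3_kappaStageA_typeTwo_mult`; (R-21) re-key; dealer LH4-plan (g11) WORD #20∕#29; plan `F0/P3c/LH4/LH4-p05/g3/PLAN-KMS-modKappaStageB.v1`).  2026-09-04.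
-/
import Summits.HodgeConjecture.HodgeConjecture.Theorems.F0P3cDyRamDiagonalKappaOrbitFibreCountMult   -- (Oκ2b)-MULT (this seat): the κ-twisted fibre count with multiplicity over `reps`; brings ★ M1, Fκ3b, the DEFS leaf
import Summits.HodgeConjecture.HodgeConjecture.Theorems.F0P3cDyRamDiagonalOrbitFibreCountMultHeads  -- ★ p856421 (LH4-p14): `finite_setOf_polarisationCosets`, `setOf_translate_eq_of_eq_mul`
import Summits.HodgeConjecture.HodgeConjecture.Theorems.F0P3cDyRamDiagonalKappaOrbitCount           -- (Oκ2c)₀ (this seat): signed engine `finsum_mem_eq_eight_mul_finsum_mul_stabiliserWeight`, (Oκ2a) re-index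
import HarnessLib

/-!
# Crux `H413`, line LH4 «(D-RAM) FOUR-FRAME» road — unit U3_Laws (iii), (KMS) ROAD «MODULO κ-STAGE B», κ-STAGE A₂ HEAD (Oκ2c)-MULT:
# `Σ_e χ⁰_i(e) · #{M : M a type-tv vertex of diag(c^{e}), T·M = M} = 8 · Σᶠ_{M₀ ∈ 𝓛₀(T)} kappaCount σ ϖ tv i M₀ · stabiliserWeight σ M₀` — NO one-coset hypothesis

Cell `hodgecm-mathlib` (D-0151), FLOOR 0, crux item H413 = `stmt-HodgeConjecture-24833`, route of record `HCCMUnconditional`; squad F0∕P3c∕LH4 (req618∕req620); registered stubs served: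
`F0P3cDyRamFourFrameU3.stub_U3_kappaModelSum` (:407) ∕ `stub_U3_kappaSignModelSum` (:449) through their U3 ED. 9 child (κ-A₂) `stub_U3_kappaStageA_typeTwo_mult` = the `hAκ2` binder of
this seat's ★-to-be heads `kappaModelSum_of_kappaStageB` ∕ `kappaSignModelSum_of_kappaStageB`.  THEOREMS ONLY (no `def`, no instance, no notation, no `sorry`); lane `--supports
stmt-HodgeConjecture-24833` (count-neutral).

THE MATHEMATICS ((R-21) currency; this seat's PLAN v1 §2 with LH4-p14's multiplicity).  §1: at a lattice `M₀` with finite unit-torus orbit and finitely many polarisation cosets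
`𝒞_tv(M₀)` (★ `polarisationCosets`), choose one representative per coset (`hΔ` by ★ `isVertexLattice_diagonal_mul_of_mem_fixedUnitStabilizer`, `hfree` by ★
`setOf_translate_eq_of_eq_mul` — LH4-p14's construction verbatim) and apply (Oκ2b)-MULT: the representatives' `cosetKappa`-sum IS `kappaCount σ ϖ tv i M₀ = Σᶠ_{C ∈ 𝒞_tv(M₀)}
cosetKappa σ i C`, so `(Σ_e χ⁰_i(e)·Σᶠ_{𝒯·M₀} #fibre_e)·[𝒰 : S_F(M₀)] = 8·[𝒯 : S̃(M₀)]·kappaCount σ ϖ tv i M₀`; at `M₀ ∈ 𝓛₀(T)` both finiteness inputs are ★ (PART 4, MultHeads §2).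
§2: (Oκ2a) re-indexing + the SIGNED averaging engine (★ `…KappaOrbitCount` §1–§2) give the head at every `tv`, and at `tv = 2` — restricted to `{M ∈ 𝓛₀(T) | IsTypeTwoPolarisable}`
(`kappaCount = 0` off it) — the (κ-A₂) sentence TOKEN FOR TOKEN: `kappaStageA_typeTwo_mult`.

WHAT IS PROVED (`N = 3`, `K : Type`, `[Finite 𝓀[K]]` for §2).
* §1 `sum_signChar_mul_finsum_ncard_fibre_mul_relIndex_eq_mul_kappaCount` (any `M₀` with finite orbit and finite `𝒞_tv`), `…_of_mem_normalisedStableLattices`.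
* §2 `cast_sum_signChar_mul_ncard_eq_eight_mul_finsum_kappaCount_mult` (any `tv`, over `𝓛₀(T)`), **`kappaStageA_typeTwo_mult`** (the (κ-A₂) sentence).
HONEST LABEL.  Count-neutral (`--supports`); nothing printed is asserted; (KMS)∕(KSS) stay PROVER TARGETS (empirical census laws in diagonal-model currency); `HC_CM` is proved only
modulo the 7 printed citations (2 remaining named inputs: hLiu418 = `stmt-HodgeConjecture-24832`, h413 = `stmt-HodgeConjecture-24833`) until rung 0 closes.

## References
* [Kottwitz1986BaseChangeUnits] R. E. Kottwitz, *Base change for unit elements of Hecke algebras*, Compositio Math. 60 (1986), §1 pp. 240–241.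
* [Rogawski1990] J. D. Rogawski, *Automorphic Representations of Unitary Groups in Three Variables*, Ann. of Math. Stud. 123 (1990), §4.9 Prop. 4.9.1 (a) p. 55, §4.10 p. 58.
* [LanglandsShelstad1987] R. P. Langlands, D. Shelstad, *On the definition of transfer factors*, Math. Ann. 278 (1987), §3.
-/

set_option autoImplicit false

noncomputable section

namespace Summit.HodgeConjecture.HodgeConjecture.Cruxes.H413.F0P3cDyRamDiagonalKappaOrbitCountMult

open Matrix
open Literature.NumberTheory.Automorphic Literature.NumberTheory.Automorphic.HermitianLattice
open Literature.NumberTheory.Automorphic.UnitaryLatticeTree Literature.NumberTheory.Automorphic.UnitaryThreeFourFrame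
open Summit.HodgeConjecture.HodgeConjecture.Cruxes.H413.F0P3cDyRamDiagonalTorusDefs
open Summit.HodgeConjecture.HodgeConjecture.Cruxes.H413.F0P3cDyRamDiagonalStrataDefs
open Summit.HodgeConjecture.HodgeConjecture.Cruxes.H413.F0P3cDyRamDiagonalOrbitAveraging
open Summit.HodgeConjecture.HodgeConjecture.Cruxes.H413.F0P3cDyRamDiagonalOrbitFibreCountHeads
open Summit.HodgeConjecture.HodgeConjecture.Cruxes.H413.F0P3cDyRamDiagonalOrbitFibreCountMultHeads
open Summit.HodgeConjecture.HodgeConjecture.Cruxes.H413.F0P3cDyRamDiagonalPolarisationCoset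
open Summit.HodgeConjecture.HodgeConjecture.Cruxes.H413.F0P3cDyRamDiagonalStableLatticesFinite
open Summit.HodgeConjecture.HodgeConjecture.Cruxes.H413.F0P3cDyRamDiagonalKappaCountDefs
open Summit.HodgeConjecture.HodgeConjecture.Cruxes.H413.F0P3cDyRamDiagonalKappaOrbitFibreCountMult
open Summit.HodgeConjecture.HodgeConjecture.Cruxes.H413.F0P3cDyRamDiagonalKappaOrbitCount
open scoped Valued WithZero Matrix MatrixGroups

variable {K : Type} [Field K] [Valued K ℤᵐ⁰]

/-! ## §1  (Oκ2b)-MULT in `kappaCount` currency -/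

open Classical in
/-- **(Oκ2b)-MULT IN `kappaCount` CURRENCY, GENERIC.**  Under the hypotheses of ★ M2 on `σ, ϖ, c`, for ANY `M₀` with finite unit-torus orbit whose set of type-`tv` polarisation
cosets is finite, and any slot `i`: `(Σ_e χ⁰_i(e)·Σᶠ_{M ∈ 𝒯·M₀} #{a : diag(ϖu^{a})·M type-tv for diag(d_e)}) · [𝒰 : S_F(M₀)] = 8 · [𝒯 : S̃(M₀)] · kappaCount σ ϖ tv i M₀` over `ℚ` —
(Oκ2b)-MULT on one representative per coset; the representatives' `cosetKappa`-sum is the finsum over ★ `polarisationCosets`, i.e. `kappaCount`.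
[cite: Kottwitz1986BaseChangeUnits, §1 pp. 240–241] [cite: Rogawski1990, §4.9 Prop. 4.9.1 (a) p. 55] [cite: LanglandsShelstad1987, §3] -/
theorem sum_signChar_mul_finsum_ncard_fibre_mul_relIndex_eq_mul_kappaCount {σ : K →+* K} (hσ : ∀ x, σ (σ x) = x) (hvσ : ∀ a, Valued.v (σ a) = Valued.v a)
    {ϖ : K} (hϖ : Valued.v ϖ = WithZero.exp (-1 : ℤ)) (ϖu : Kˣ) (hϖu : (ϖu : K) = ϖ)
    {c : K} (hσc : σ c = c) (hcv : Valued.v c = 1) (hc : ¬ ∃ z : K, z * σ z = c)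
    (hdich : ∀ x : K, σ x = x → x ≠ 0 → (∃ z : K, z * σ z = x) ∨ ∃ z : K, z * σ z = c * x)
    {M₀ : Submodule 𝒪[K] (Fin 3 → K)}
    (hfin : {M : Submodule 𝒪[K] (Fin 3 → K) | ∃ u ∈ unitTorus K 3, M = mapGL (diagGLUnits u) M₀}.Finite) (tv : ℕ)
    (hCos : (polarisationCosets σ ϖ tv M₀).Finite) (i : Fin 3) :
    (∑ e : Fin 3 → Bool, (signChar i e : ℚ) *
        ((∑ᶠ M ∈ {M : Submodule 𝒪[K] (Fin 3 → K) | ∃ u ∈ unitTorus K 3, M = mapGL (diagGLUnits u) M₀},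
          ({a : Fin 3 → ℤ | IsVertexLattice σ ϖ (Matrix.diagonal fun j => if e j then c else (1 : K)) tv
            (mapGL (diagGLUnits fun j => ϖu ^ a j) M)} : Set _).ncard : ℕ) : ℚ)) *
      (((fixedUnitStabilizer σ M₀).relIndex (fixedUnitTorus σ 3) : ℕ) : ℚ) =
    8 * (((unitStabilizer M₀).relIndex (unitTorus K 3) : ℕ) : ℚ) * (kappaCount σ ϖ tv i M₀ : ℚ) := by
  classical
  set Cos : Set (Set (Fin 3 → K)) := polarisationCosets σ ϖ tv M₀ with hCosdef
  have hrep : ∀ C ∈ Cos, ∃ D : Fin 3 → K, ((∀ i, σ (D i) = D i ∧ D i ≠ 0) ∧ IsVertexLattice σ ϖ (Matrix.diagonal D) tv M₀) ∧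
      C = {D' : Fin 3 → K | ∃ u ∈ fixedUnitStabilizer σ M₀, ∀ i, D' i = D i * ((u i : Kˣ) : K)} := fun C hC => hC
  choose! rep hrepP hrepC using hrep
  have hrepinj : Set.InjOn rep Cos := fun C hC C' hC' h => by rw [hrepC C hC, hrepC C' hC', h]
  set reps : Finset (Fin 3 → K) := hCos.toFinset.image rep with hreps
  have hmem : ∀ D₁ : Fin 3 → K, D₁ ∈ reps ↔ ∃ C ∈ Cos, rep C = D₁ := fun D₁ => by
    rw [hreps, Finset.mem_image]
    simp only [Set.Finite.mem_toFinset]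
  -- the representatives' `cosetKappa`-sum is `kappaCount`
  have hsum : ∑ D ∈ reps, (cosetKappa σ i {D' : Fin 3 → K | ∃ u ∈ fixedUnitStabilizer σ M₀, ∀ j, D' j = D j * ((u j : Kˣ) : K)} : ℚ) =
      (kappaCount σ ϖ tv i M₀ : ℚ) := by
    rw [kappaCount_eq, finsum_mem_eq_finite_toFinset_sum _ hCos, Int.cast_sum, hreps,
      Finset.sum_image (fun C hC C' hC' h => hrepinj ((Set.Finite.mem_toFinset hCos).1 hC) ((Set.Finite.mem_toFinset hCos).1 hC') h)]
    refine Finset.sum_congr rfl fun C hC => ?_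
    rw [← hrepC C ((Set.Finite.mem_toFinset hCos).1 hC)]
  rw [← hsum]
  refine sum_signChar_mul_finsum_ncard_fibre_mul_relIndex_eq_mul_sum_cosetKappa hσ hvσ hϖ ϖu hϖu hσc hcv hc hdich hfin tv reps ?_ ?_ ?_ i
  · intro D₁ hD₁
    obtain ⟨C, hC, rfl⟩ := (hmem D₁).1 hD₁
    exact (hrepP C hC).1
  · intro D hD
    constructor
    · intro hV
      have hC : {D' : Fin 3 → K | ∃ u ∈ fixedUnitStabilizer σ M₀, ∀ i, D' i = D i * ((u i : Kˣ) : K)} ∈ Cos := ⟨D, ⟨hD, hV⟩, rfl⟩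
      have hDmem : D ∈ {D' : Fin 3 → K | ∃ u ∈ fixedUnitStabilizer σ M₀, ∀ i, D' i = D i * ((u i : Kˣ) : K)} :=
        ⟨1, Subgroup.one_mem _, fun i => by rw [Pi.one_apply, Units.val_one, mul_one]⟩
      rw [hrepC _ hC] at hDmem
      obtain ⟨u, hu, hDu⟩ := hDmem
      exact ⟨rep _, (hmem _).2 ⟨_, hC, rfl⟩, u, hu, hDu⟩
    · rintro ⟨D₁, hD₁, u, hu, hDu⟩
      obtain ⟨C, hC, rfl⟩ := (hmem D₁).1 hD₁
      have hfun : (fun i => rep C i * ((u i : Kˣ) : K)) = D := funext fun i => (hDu i).symm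
      exact hfun ▸ isVertexLattice_diagonal_mul_of_mem_fixedUnitStabilizer σ (hrepP C hC).2 hu
  · intro D₁ hD₁ D₂ hD₂ u hu hDu
    obtain ⟨C₁, hC₁, rfl⟩ := (hmem D₁).1 hD₁
    obtain ⟨C₂, hC₂, rfl⟩ := (hmem D₂).1 hD₂
    have h12 : C₁ = C₂ := by
      rw [hrepC C₁ hC₁, hrepC C₂ hC₂]
      exact setOf_translate_eq_of_eq_mul σ M₀ hu hDu
    rw [h12]

/-- **(Oκ2b)-MULT IN `kappaCount` CURRENCY AT `M₀ ∈ 𝓛₀(T)`** (orbit finite ★ PART 4; cosets finite ★ MultHeads §2).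
[cite: Kottwitz1986BaseChangeUnits, §1 pp. 240–241] [cite: LanglandsShelstad1987, §3] -/
theorem sum_signChar_mul_finsum_ncard_fibre_mul_relIndex_eq_mul_kappaCount_of_mem_normalisedStableLattices [Finite 𝓀[K]]
    {σ : K →+* K} (hσ : ∀ x, σ (σ x) = x) (hvσ : ∀ a, Valued.v (σ a) = Valued.v a)
    {ϖ : K} (hϖ : Valued.v ϖ = WithZero.exp (-1 : ℤ)) (ϖu : Kˣ) (hϖu : (ϖu : K) = ϖ)
    {c : K} (hσc : σ c = c) (hcv : Valued.v c = 1) (hc : ¬ ∃ z : K, z * σ z = c)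
    (hdich : ∀ x : K, σ x = x → x ≠ 0 → (∃ z : K, z * σ z = x) ∨ ∃ z : K, z * σ z = c * x)
    {s : Fin 3 → K} (hs : ∀ i, Valued.v (s i) = 1) (hreg : ∀ i j, i ≠ j → s i ≠ s j)
    (T : GL (Fin 3) K) (hT : (T : Matrix (Fin 3) (Fin 3) K) = Matrix.diagonal s)
    {M₀ : Submodule 𝒪[K] (Fin 3 → K)} (hM₀ : M₀ ∈ normalisedStableLattices T) (tv : ℕ) (i : Fin 3) :
    (∑ e : Fin 3 → Bool, (signChar i e : ℚ) *
        ((∑ᶠ M ∈ {M : Submodule 𝒪[K] (Fin 3 → K) | ∃ u ∈ unitTorus K 3, M = mapGL (diagGLUnits u) M₀},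
          ({a : Fin 3 → ℤ | IsVertexLattice σ ϖ (Matrix.diagonal fun j => if e j then c else (1 : K)) tv
            (mapGL (diagGLUnits fun j => ϖu ^ a j) M)} : Set _).ncard : ℕ) : ℚ)) *
      (((fixedUnitStabilizer σ M₀).relIndex (fixedUnitTorus σ 3) : ℕ) : ℚ) =
    8 * (((unitStabilizer M₀).relIndex (unitTorus K 3) : ℕ) : ℚ) * (kappaCount σ ϖ tv i M₀ : ℚ) := by
  have hfin := finite_unitTorus_orbit_of_mem_normalisedStableLattices hϖ hs hreg T hT hM₀
  obtain ⟨⟨g, hg⟩, -, hnorm⟩ := hM₀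
  exact sum_signChar_mul_finsum_ncard_fibre_mul_relIndex_eq_mul_kappaCount hσ hvσ hϖ ϖu hϖu hσc hcv hc hdich hfin tv
    (finite_setOf_polarisationCosets hσ hvσ hϖ ϖu hϖu hσc hcv hdich g hg hnorm (relIndex_fixedUnitStabilizer_ne_zero_of_finite σ hfin) tv) i

/-! ## §2  The (Oκ2c)-MULT head and the (κ-A₂) sentence -/

/-- **(Oκ2c)-MULT · THE κ-WEIGHTED ORBIT COUNT, ANY VERTEX TYPE, NO ONE-COSET HYPOTHESIS.**  `T = diag(s)` a regular unit diagonal, `σ` an isometric involution, `ϖ = ↑ϖu` a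
uniformiser, `c` a `σ`-fixed NON-NORM unit with the dichotomy, `i` a slot: `↑(Σ_e χ⁰_i(e)·#{M : M type-tv for diag(d_e), T·M = M}) = 8·Σᶠ_{M₀ ∈ 𝓛₀(T)} kappaCount σ ϖ tv i M₀ ·
stabiliserWeight σ M₀` — (Oκ2a) + the signed engine fed with §1 at every `M₀ ∈ 𝓛₀(T)`. [cite: Kottwitz1986BaseChangeUnits, §1 pp. 240–241] [cite: Rogawski1990, §4.9 Prop. 4.9.1 (a) p. 55]
[cite: LanglandsShelstad1987, §3] -/
theorem cast_sum_signChar_mul_ncard_eq_eight_mul_finsum_kappaCount_mult [Finite 𝓀[K]] {σ : K →+* K} (hσ : ∀ x, σ (σ x) = x)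
    (hvσ : ∀ a, Valued.v (σ a) = Valued.v a) {ϖ : K} (hϖ : Valued.v ϖ = WithZero.exp (-1 : ℤ)) (ϖu : Kˣ) (hϖu : (ϖu : K) = ϖ)
    {c : K} (hσc : σ c = c) (hcv : Valued.v c = 1) (hc : ¬ ∃ z : K, z * σ z = c)
    (hdich : ∀ x : K, σ x = x → x ≠ 0 → (∃ z : K, z * σ z = x) ∨ ∃ z : K, z * σ z = c * x)
    {s : Fin 3 → K} (hs : ∀ i, Valued.v (s i) = 1) (hreg : ∀ i j, i ≠ j → s i ≠ s j)
    (T : GL (Fin 3) K) (hT : (T : Matrix (Fin 3) (Fin 3) K) = Matrix.diagonal s) (tv : ℕ) (i : Fin 3) :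
    (((∑ e : Fin 3 → Bool,
        (![(if e 1 then -1 else 1) * (if e 2 then -1 else 1),
           (if e 0 then -1 else 1) * (if e 2 then -1 else 1),
           (if e 0 then -1 else 1) * (if e 1 then -1 else 1)] : Fin 3 → ℤ) i *
          ({M : Submodule 𝒪[K] (Fin 3 → K) |
            IsVertexLattice σ ϖ (Matrix.diagonal fun j => if e j then c else (1 : K)) tv M ∧ mapGL T M = M}.ncard : ℤ) : ℤ) : ℚ)) =
      8 * ∑ᶠ M₀ ∈ normalisedStableLattices T, (kappaCount σ ϖ tv i M₀ : ℚ) * stabiliserWeight σ M₀ := by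
  classical
  rw [cast_sum_signChar_mul_ncard_fixed_vertices_eq_finsum hvσ hϖ ϖu hϖu hcv hs hreg T hT tv i]
  refine finsum_mem_eq_eight_mul_finsum_mul_stabiliserWeight hϖ hs hreg T hT σ _ _ fun M₀ hM₀ => ?_
  have hfinO := finite_unitTorus_orbit_of_mem_normalisedStableLattices hϖ hs hreg T hT hM₀
  have hswap : (∑ᶠ M ∈ {M : Submodule 𝒪[K] (Fin 3 → K) | ∃ u ∈ unitTorus K 3, M = mapGL (diagGLUnits u) M₀},
      ∑ e : Fin 3 → Bool, (signChar i e : ℚ) *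
        ((({a : Fin 3 → ℤ | IsVertexLattice σ ϖ (Matrix.diagonal fun j => if e j then c else (1 : K)) tv
            (mapGL (diagGLUnits fun j => ϖu ^ a j) M)} : Set _).ncard : ℕ) : ℚ)) =
      ∑ e : Fin 3 → Bool, (signChar i e : ℚ) *
        ((∑ᶠ M ∈ {M : Submodule 𝒪[K] (Fin 3 → K) | ∃ u ∈ unitTorus K 3, M = mapGL (diagGLUnits u) M₀},
          ({a : Fin 3 → ℤ | IsVertexLattice σ ϖ (Matrix.diagonal fun j => if e j then c else (1 : K)) tv
            (mapGL (diagGLUnits fun j => ϖu ^ a j) M)} : Set _).ncard : ℕ) : ℚ) := by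
    rw [finsum_mem_eq_finite_toFinset_sum _ hfinO, Finset.sum_comm]
    refine Finset.sum_congr rfl fun e _ => ?_
    rw [finsum_mem_eq_finite_toFinset_sum _ hfinO, Nat.cast_sum, Finset.mul_sum]
  rw [hswap]
  exact sum_signChar_mul_finsum_ncard_fibre_mul_relIndex_eq_mul_kappaCount_of_mem_normalisedStableLattices hσ hvσ hϖ ϖu hϖu hσc hcv hc hdich hs hreg T hT hM₀ tv i

/-- **(κ-A₂) `stub_U3_kappaStageA_typeTwo_mult` — THE U3 ED. 9 CHILD, TOKEN FOR TOKEN** (= the `hAκ2` binder of `kappaModelSum_of_kappaStageB` ∕ `kappaSignModelSum_of_kappaStageB`):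
at `tv = 2`, `↑(Σ_e χ⁰_i(e)·#{M : M type-2 for diag(d_e), T·M = M}) = 8·Σᶠ_{M₀ ∈ {M ∈ 𝓛₀(T) | IsTypeTwoPolarisable σ ϖ M}} kappaCount σ ϖ 2 i M₀ · stabiliserWeight σ M₀` — the
previous theorem restricted to the type-2-polarisable part (`kappaCount σ ϖ 2 i = 0` off it). [cite: Kottwitz1986BaseChangeUnits, §1 pp. 240–241] [cite: Rogawski1990, §4.9 Prop. 4.9.1 (a) p. 55]
[cite: LanglandsShelstad1987, §3] -/
theorem kappaStageA_typeTwo_mult :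
    ∀ {K : Type} [Field K] [Valued K ℤᵐ⁰] [Finite 𝓀[K]] {σ : K →+* K}, (∀ x, σ (σ x) = x) → (∀ a, Valued.v (σ a) = Valued.v a) →
      ∀ {ϖ : K}, Valued.v ϖ = WithZero.exp (-1 : ℤ) → ∀ (ϖu : Kˣ), (ϖu : K) = ϖ →
      ∀ {c : K}, σ c = c → Valued.v c = 1 → (¬ ∃ z : K, z * σ z = c) →
        (∀ x : K, σ x = x → x ≠ 0 → (∃ z : K, z * σ z = x) ∨ ∃ z : K, z * σ z = c * x) →
      ∀ {s : Fin 3 → K}, (∀ i, Valued.v (s i) = 1) → (∀ i j, i ≠ j → s i ≠ s j) →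
      ∀ (T : GL (Fin 3) K), (T : Matrix (Fin 3) (Fin 3) K) = Matrix.diagonal s → ∀ (i : Fin 3),
        (((∑ e : Fin 3 → Bool,
            (![(if e 1 then -1 else 1) * (if e 2 then -1 else 1),
               (if e 0 then -1 else 1) * (if e 2 then -1 else 1),
               (if e 0 then -1 else 1) * (if e 1 then -1 else 1)] : Fin 3 → ℤ) i *
              ({M : Submodule 𝒪[K] (Fin 3 → K) |
                IsVertexLattice σ ϖ (Matrix.diagonal fun j => if e j then c else (1 : K)) 2 M ∧ mapGL T M = M}.ncard : ℤ) : ℤ) : ℚ)) =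
          8 * ∑ᶠ M₀ ∈ {M : Submodule 𝒪[K] (Fin 3 → K) | M ∈ normalisedStableLattices T ∧ IsTypeTwoPolarisable σ ϖ M},
            (kappaCount σ ϖ 2 i M₀ : ℚ) * stabiliserWeight σ M₀ := by
  intro K _ _ _ σ hσ hvσ ϖ hϖ ϖu hϖu c hσc hcv hc hdich s hs hreg T hT i
  classical
  rw [cast_sum_signChar_mul_ncard_eq_eight_mul_finsum_kappaCount_mult hσ hvσ hϖ ϖu hϖu hσc hcv hc hdich hs hreg T hT 2 i]
  congr 1
  have h𝓛 : (normalisedStableLattices T).Finite := finite_setOf_normalised_diagonal_fixed_latt hϖ s hs hreg T hT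
  have hset : {M : Submodule 𝒪[K] (Fin 3 → K) | M ∈ normalisedStableLattices T ∧ IsTypeTwoPolarisable σ ϖ M} =
      ↑(h𝓛.toFinset.filter fun M => IsTypeTwoPolarisable σ ϖ M) := by
    ext M
    simp only [Set.mem_setOf_eq, Finset.coe_filter, Set.Finite.mem_toFinset]
  rw [hset, finsum_mem_coe_finset, finsum_mem_eq_finite_toFinset_sum _ h𝓛, Finset.sum_filter_of_ne]
  intro M _ hne
  by_contra hpol
  apply hne
  rw [kappaCount_two_eq_zero_of_not_isTypeTwoPolarisable σ ϖ i M hpol, Int.cast_zero, zero_mul]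

end Summit.HodgeConjecture.HodgeConjecture.Cruxes.H413.F0P3cDyRamDiagonalKappaOrbitCountMult

end
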